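import Literature.MathematicalPhysics.QuantumFieldTheory.LatticeSiteRPMechanism
import HarnessLib

/-!
# Lattice reflection positivity with a shared block: positive semidefinite couplings

Theorem-only companion to `LatticeSiteRPMechanism` (same objects: the product probability
measure `μ = piMeasure μ₀` on `Ω = ι → G`, the coordinate splice `splice P (V, W)`, a reflection
`Θ` preserving `μ`, fixing the shared block `M` and mapping the positive block `P` off `P`).
The core lemma there treats the quadratic pairing `∫ Φ · conj (Φ ∘ Θ)`; here we record

* `integral_mul_conj_comp_of_shared` — the **sesquilinear** form of the core identity (no
  crossing block): `∫ Φ(U) conj Ψ(ΘU) dμ = ∫ χ_Φ(V) conj χ_Ψ(V) dμ(V)` with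
  `χ_Φ(V) = ∫ Φ(splice P (V, W)) dμ(W)` (a function of the `M`-coordinates of `V`);
* `integral_sum_coupling_nonneg` — **reflection positivity with a positive semidefinite
  coupling on the shared block**: if `Q(U)` is a positive semidefinite matrix depending only on
  the `M`-coordinates and `Φ_k` depend only on `P ∪ M` (all bounded measurable), then
  `0 ≤ ∫ ∑_{k,l} Q_{kl}(U) Φ_k(U) conj Φ_l(ΘU) dμ(U)`.

The second statement is the abstract form of MARGINAL reflection positivity for a weight that
is a reflection-positive kernel rather than a product `g · (g ∘ Θ)` — e.g. a fermion determinant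
after Gaussian Grassmann integration (Osterwalder–Seiler, Ann. Phys. 110 (1978) 440, §2–3;
Kennedy–Lieb 1986, integrated fermions keep RP). All statements here are proved. [folklore]
-/

open MeasureTheory ProbabilityTheory Finset Filter
open scoped ComplexOrder ENNReal NNReal ComplexConjugate

namespace Literature.MathematicalPhysics.QuantumFieldTheory.LatticeRP

noncomputable section

variable {ι : Type*} [Fintype ι] [DecidableEq ι] {G : Type*} [MeasurableSpace G]
variable (μ₀ : Measure G) [IsProbabilityMeasure μ₀]
variable (M P : Finset ι) (Θ : (ι → G) → (ι → G))

/-- **Sesquilinear core identity of lattice reflection positivity with a shared block** (no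
crossing coordinates). Let `Θ` preserve the product measure, fix the `M`-coordinates, and let the
`P`-coordinates of `Θ U` depend only on `U` off `P`, with `M` disjoint from `P`. Then for bounded
measurable `Φ, Ψ` depending only on the coordinates in `P ∪ M`,
`∫ Φ(U) conj Ψ(ΘU) dμ = ∫ χ_Φ(V) conj χ_Ψ(V) dμ(V)`, `χ_Φ(V) = ∫ Φ(splice P (V, W)) dμ(W)`. [folklore] -/
theorem integral_mul_conj_comp_of_shared
    (hΘ : MeasurePreserving Θ (piMeasure μ₀) (piMeasure μ₀))
    (hΘM : ∀ U, ∀ i ∈ M, Θ U i = U i)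
    (hΘdep : ∀ e ∈ P, DependsOn (fun U => Θ U e) ((Pᶜ : Finset ι) : Set ι))
    (hMP : Disjoint M P)
    {Φ Ψ : (ι → G) → ℂ} (hΦm : Measurable Φ) (hΨm : Measurable Ψ) {K : ℝ}
    (hΦb : ∀ U, ‖Φ U‖ ≤ K) (hΨb : ∀ U, ‖Ψ U‖ ≤ K)
    (hΦdep : DependsOn Φ ((P ∪ M : Finset ι) : Set ι)) (hΨdep : DependsOn Ψ ((P ∪ M : Finset ι) : Set ι)) :
    ∫ U, Φ U * conj (Ψ (Θ U)) ∂(piMeasure μ₀) =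
      ∫ V, (∫ W, Φ (splice P (V, W)) ∂(piMeasure μ₀)) *
        conj (∫ W, Ψ (splice P (V, W)) ∂(piMeasure μ₀)) ∂(piMeasure μ₀) := by
  set μ : Measure (ι → G) := piMeasure μ₀ with hμ
  have hΘm : Measurable Θ := hΘ.measurable
  have hconj : Measurable (starRingEnd ℂ : ℂ → ℂ) := Complex.continuous_conj.measurable
  have hPM : ∀ {F : (ι → G) → ℂ}, DependsOn F ((P ∪ M : Finset ι) : Set ι) →
      DependsOn F ((P ∪ ∅ ∪ M : Finset ι) : Set ι) := fun h => by rwa [Finset.union_empty]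
  have hΘdep' : ∀ e ∈ P ∪ ∅, DependsOn (fun U => Θ U e) ((Pᶜ : Finset ι) : Set ι) := by
    rw [Finset.union_empty]; exact hΘdep
  -- the averages over the `P`-coordinates
  set ψ : (ι → G) → ℂ := fun V => ∫ W, Φ (splice P (V, W)) ∂μ with hψ
  set χ : (ι → G) → ℂ := fun V => ∫ W, Ψ (splice P (V, W)) ∂μ with hχ
  have hψm : Measurable ψ := measurable_integral_parametric (hΦm.comp (measurable_splice P))
  have hχm : Measurable χ := measurable_integral_parametric (hΨm.comp (measurable_splice P))
  have hψb : ∀ V, ‖ψ V‖ ≤ K := fun V => norm_integral_le_of_norm_le_prob fun W => hΦb _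
  -- `ψ` depends only on the shared block
  have hdepM : ∀ {F : (ι → G) → ℂ}, DependsOn F ((P ∪ M : Finset ι) : Set ι) →
      DependsOn (fun V => ∫ W, F (splice P (V, W)) ∂μ) ((M : Finset ι) : Set ι) := by
    intro F hF V V' hVV'
    refine integral_congr_ae (ae_of_all _ fun W => hF fun i hi => ?_)
    simp only [splice_apply]
    split_ifs with hP
    · rfl
    · have hiM : i ∈ M := by
        rcases Finset.mem_union.1 (Finset.mem_coe.1 hi) with h | h
        · exact absurd h hP
        · exact h
      exact hVV' i (Finset.mem_coe.2 hiM)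
  have hψdep : DependsOn ψ ((M : Finset ι) : Set ι) := hdepM hΦdep
  have hΨΘdep : DependsOn (fun U => conj (Ψ (Θ U))) ((Pᶜ : Finset ι) : Set ι) := fun U V hUV =>
    congrArg conj (dependsOn_comp_of_shared P ∅ M Θ (hPM hΨdep) hΘM hΘdep' hMP hUV)
  -- Step A: integrate out the `P`-coordinates of the positive factor
  have stepA : ∫ U, Φ U * conj (Ψ (Θ U)) ∂μ = ∫ V, conj (Ψ (Θ V)) * ψ V ∂μ := by
    have hFm : Measurable fun U => Φ U * conj (Ψ (Θ U)) := hΦm.mul (hconj.comp (hΨm.comp hΘm))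
    rw [← integral_comp_eq_of_measurePreserving (measurePreserving_splice μ₀ P) hFm]
    have hGi : Integrable (fun q : (ι → G) × (ι → G) =>
        Φ (splice P q) * conj (Ψ (Θ (splice P q)))) (μ.prod μ) :=
      integrable_of_norm_le (hFm.comp (measurable_splice P)) (K := K * K) fun q => by
        rw [norm_mul, Complex.norm_conj]
        exact mul_le_mul (hΦb _) (hΨb _) (norm_nonneg _) ((norm_nonneg _).trans (hΦb (splice P q)))
    rw [integral_prod _ hGi]
    refine integral_congr_ae (ae_of_all _ fun V => ?_)
    have hΘV : ∀ W, conj (Ψ (Θ (splice P (V, W)))) = conj (Ψ (Θ V)) := fun W =>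
      apply_splice_of_dependsOn_compl hΨΘdep V W
    simp_rw [hΘV]
    rw [integral_mul_const, mul_comm]
  -- Step B: `Θ`-invariance moves the reflection onto the other factor
  have stepB : ∫ V, conj (Ψ (Θ V)) * ψ V ∂μ = ∫ V, conj (Ψ V) * ψ V ∂μ := by
    have h1 : ∀ V, ψ V = ψ (Θ V) := fun V => hψdep fun i hi => (hΘM V i (Finset.mem_coe.1 hi)).symm
    calc ∫ V, conj (Ψ (Θ V)) * ψ V ∂μ = ∫ V, conj (Ψ (Θ V)) * ψ (Θ V) ∂μ := by simp_rw [← h1]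
      _ = ∫ V, conj (Ψ V) * ψ V ∂μ :=
          integral_comp_eq_of_measurePreserving hΘ ((hconj.comp hΨm).mul hψm)
  -- Step C: integrate out the `P`-coordinates of the reflected factor
  have stepC : ∫ V, conj (Ψ V) * ψ V ∂μ = ∫ V, ψ V * conj (χ V) ∂μ := by
    have hFm : Measurable fun V => conj (Ψ V) * ψ V := (hconj.comp hΨm).mul hψm
    rw [← integral_comp_eq_of_measurePreserving (measurePreserving_splice μ₀ P) hFm]
    have hGi : Integrable (fun q : (ι → G) × (ι → G) =>
        conj (Ψ (splice P q)) * ψ (splice P q)) (μ.prod μ) :=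
      integrable_of_norm_le (hFm.comp (measurable_splice P)) (K := K * K) fun q => by
        rw [norm_mul, Complex.norm_conj]
        exact mul_le_mul (hΨb _) (hψb _) (norm_nonneg _) ((norm_nonneg _).trans (hΨb (splice P q)))
    rw [integral_prod _ hGi]
    refine integral_congr_ae (ae_of_all _ fun V => ?_)
    have hψV : ∀ W, ψ (splice P (V, W)) = ψ V := fun W =>
      apply_splice_of_dependsOn_of_disjoint hψdep hMP V W
    simp only
    simp_rw [hψV]
    rw [integral_mul_const, ← integral_conj, mul_comm]
  rw [stepA, stepB, stepC]

/-- **Abstract marginal reflection positivity with a positive semidefinite coupling on the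
shared block.** Let `Θ` preserve the product probability measure `μ` on `Ω = ι → G`, fix the
`M`-coordinates, and let the `P`-coordinates of `Θ U` depend only on `U` off `P` (`M ∩ P = ∅`).
Let `Q : Ω → M_K(ℂ)` be bounded measurable, positive semidefinite at every point and depending
only on the `M`-coordinates, and let `Φ_k` (`k ∈ K` finite) be bounded measurable depending only
on `P ∪ M`. Then `0 ≤ ∫ ∑_{k,l} Q_{kl}(U) Φ_k(U) conj Φ_l(ΘU) dμ(U)`.
Proof: by `integral_mul_conj_comp_of_shared` the integral is `∫ ∑ Q_{kl}(V) χ_k(V) conj χ_l(V)`,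
pointwise a positive semidefinite quadratic form. [folklore] -/
theorem integral_sum_coupling_nonneg
    (hΘ : MeasurePreserving Θ (piMeasure μ₀) (piMeasure μ₀))
    (hΘM : ∀ U, ∀ i ∈ M, Θ U i = U i)
    (hΘdep : ∀ e ∈ P, DependsOn (fun U => Θ U e) ((Pᶜ : Finset ι) : Set ι))
    (hMP : Disjoint M P)
    {K : Type*} [Fintype K] [DecidableEq K] {Q : (ι → G) → Matrix K K ℂ} {Φ : K → (ι → G) → ℂ}
    (hQm : ∀ k l, Measurable fun U => Q U k l) (hΦm : ∀ k, Measurable (Φ k))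
    {CQ CΦ : ℝ} (hQb : ∀ U k l, ‖Q U k l‖ ≤ CQ) (hΦb : ∀ k U, ‖Φ k U‖ ≤ CΦ)
    (hQdep : ∀ k l, DependsOn (fun U => Q U k l) ((M : Finset ι) : Set ι))
    (hQpsd : ∀ U, (Q U).PosSemidef)
    (hΦdep : ∀ k, DependsOn (Φ k) ((P ∪ M : Finset ι) : Set ι)) :
    0 ≤ ∫ U, ∑ k, ∑ l, Q U k l * Φ k U * conj (Φ l (Θ U)) ∂(piMeasure μ₀) := by
  set μ : Measure (ι → G) := piMeasure μ₀ with hμ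
  have hΘm : Measurable Θ := hΘ.measurable
  have hconj : Measurable (starRingEnd ℂ : ℂ → ℂ) := Complex.continuous_conj.measurable
  set K₀ : ℝ := max (|CQ| * |CΦ|) |CΦ| with hK₀
  have hb1 : ∀ k l U, ‖Q U k l * Φ k U‖ ≤ K₀ := fun k l U => by
    rw [norm_mul]
    exact (mul_le_mul ((hQb U k l).trans (le_abs_self _)) ((hΦb k U).trans (le_abs_self _))
      (norm_nonneg _) (abs_nonneg _)).trans (le_max_left _ _)
  have hb2 : ∀ k U, ‖Φ k U‖ ≤ K₀ := fun k U => ((hΦb k U).trans (le_abs_self _)).trans (le_max_right _ _)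
  -- the averages over the `P`-coordinates
  set χ : K → (ι → G) → ℂ := fun k V => ∫ W, Φ k (splice P (V, W)) ∂μ with hχ
  have hχm : ∀ k, Measurable (χ k) := fun k =>
    measurable_integral_parametric ((hΦm k).comp (measurable_splice P))
  have hχb : ∀ k V, ‖χ k V‖ ≤ K₀ := fun k V => norm_integral_le_of_norm_le_prob fun W => hb2 k _
  -- each term of the double sum
  have hterm : ∀ k l, ∫ U, Q U k l * Φ k U * conj (Φ l (Θ U)) ∂μ =
      ∫ V, Q V k l * (χ k V * conj (χ l V)) ∂μ := by
    intro k l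
    have hdep : DependsOn (fun U => Q U k l * Φ k U) ((P ∪ M : Finset ι) : Set ι) := by
      intro U V hUV
      have h1 : Q U k l = Q V k l :=
        hQdep k l fun i hi => hUV i (by rw [Finset.coe_union]; exact Or.inr hi)
      have h2 : Φ k U = Φ k V := hΦdep k hUV
      simp only [h1, h2]
    refine (integral_mul_conj_comp_of_shared μ₀ M P Θ hΘ hΘM hΘdep hMP
      (Φ := fun U => Q U k l * Φ k U) (Ψ := Φ l) ((hQm k l).mul (hΦm k)) (hΦm l)
      (hb1 k l) (hb2 l) hdep (hΦdep l)).trans ?_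
    refine integral_congr_ae (ae_of_all _ fun V => ?_)
    have hQV : ∀ W, Q (splice P (V, W)) k l = Q V k l := fun W =>
      apply_splice_of_dependsOn_of_disjoint (hQdep k l) hMP V W
    simp only [hχ]
    simp_rw [hQV]
    rw [integral_const_mul, mul_assoc]
  -- integrability of the terms
  have hint : ∀ k l, Integrable (fun U => Q U k l * Φ k U * conj (Φ l (Θ U))) μ := fun k l =>
    integrable_of_norm_le (((hQm k l).mul (hΦm k)).mul (hconj.comp ((hΦm l).comp hΘm)))
      (K := K₀ * K₀) fun U => by
        rw [norm_mul, Complex.norm_conj]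
        exact mul_le_mul (hb1 k l U) (hb2 l _) (norm_nonneg _) ((norm_nonneg _).trans (hb1 k l U))
  have hint' : ∀ k l, Integrable (fun V => Q V k l * (χ k V * conj (χ l V))) μ := fun k l =>
    integrable_of_norm_le ((hQm k l).mul ((hχm k).mul (hconj.comp (hχm l))))
      (K := |CQ| * (K₀ * K₀)) fun V => by
        rw [norm_mul, norm_mul, Complex.norm_conj]
        exact mul_le_mul ((hQb V k l).trans (le_abs_self _))
          (mul_le_mul (hχb k V) (hχb l V) (norm_nonneg _) ((norm_nonneg _).trans (hχb k V)))
          (by positivity) (abs_nonneg _)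
  -- exchange sum and integral, twice
  have hswap : ∫ U, ∑ k, ∑ l, Q U k l * Φ k U * conj (Φ l (Θ U)) ∂μ =
      ∫ V, ∑ k, ∑ l, Q V k l * (χ k V * conj (χ l V)) ∂μ := by
    rw [integral_finsetSum _ fun k _ => integrable_finsetSum _ fun l _ => hint k l,
      integral_finsetSum _ fun k _ => integrable_finsetSum _ fun l _ => hint' k l]
    refine Finset.sum_congr rfl fun k _ => ?_
    rw [integral_finsetSum _ fun l _ => hint k l, integral_finsetSum _ fun l _ => hint' k l]
    exact Finset.sum_congr rfl fun l _ => hterm k l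
  rw [hswap]
  -- pointwise positivity of the quadratic form
  have hpt : ∀ V, 0 ≤ ∑ k, ∑ l, Q V k l * (χ k V * conj (χ l V)) := by
    intro V
    have h := (Matrix.posSemidef_iff_dotProduct_mulVec.mp (hQpsd V)).2 (fun l => conj (χ l V))
    convert h using 1
    simp only [dotProduct, Matrix.mulVec, Pi.star_apply, RCLike.star_def, Complex.conj_conj,
      Finset.mul_sum]
    exact Finset.sum_congr rfl fun k _ => Finset.sum_congr rfl fun l _ => by ring
  have hre : ∀ V, (∑ k, ∑ l, Q V k l * (χ k V * conj (χ l V))) =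
      (((∑ k, ∑ l, Q V k l * (χ k V * conj (χ l V))).re : ℝ) : ℂ) := fun V => by
    obtain ⟨-, him⟩ := Complex.nonneg_iff.1 (hpt V)
    exact Complex.ext (by simp) (by simp [← him])
  rw [integral_congr_ae (ae_of_all _ hre), integral_complex_ofReal]
  exact Complex.zero_le_real.2 (integral_nonneg fun V => (Complex.nonneg_iff.1 (hpt V)).1)

end

end Literature.MathematicalPhysics.QuantumFieldTheory.LatticeRP
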